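import Summits.KontsevichZagierPeriods.KontsevichZagierPeriods.Theses.SymplecticScissors

/-!
# `PlanarCompiler` (stmt-KontsevichZagierPeriods-10058) — negative side II: tightness of the
Green generator of the (inlined) antecedent `RealOnePeriodRelations`

The antecedent of the crux adds to rules 1a/1b/2 the GREEN GENERATOR
`[∫₀¹A(t,0)dt] + [∫₀¹(B − A)(1−t,t)dt] − [∫₀¹B(0,t)dt]` for `A, B` ℚ-semialgebraic and continuous on
the CLOSED standard triangle with a `C¹` potential on the open triangle; its soundness
(`eval = ∮_{∂Δ}(A da + B db) = 0`) uses the closed-triangle continuity essentially. THEOREM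
`greenRelaxed_unsound`: weaken continuity to the triangle minus ONE vertex (all else verbatim) and
the angle form `A = −b/(a²+b²)`, `B = a/(a²+b²)`, `S = arctan(b/a)` is admitted, of value `π/2`
(`≥ 1` proved). So the generator is typed tightly, residues at vertices are NOT Green instances
(the transfer `CurvePeriodsTransfer` must deliver boundary-continuous data), and the compiler only
meets bounded continuous `A, B`.
[Kontsevich–Zagier 2001, §1.2; Huber–Wüstholz 2022, Thm. 13.3]
-/

noncomputable section

open MeasureTheory Set MvPolynomial
open Literature.NumberTheory.Transcendental Literature.ModelTheory.ExponentialFields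

namespace Summit.KontsevichZagierPeriods.SymplecticScissors.PlanarCompilerNegative

/-! ## §4 ANTECEDENT AUDIT — tightness of the inlined Green generator

The antecedent of the crux (= `RealOnePeriodRelations`, inlined) adds to rules 1a/1b/2 the GREEN
GENERATOR: `[∫₀¹A(t,0)dt] + [∫₀¹(B − A)(1−t,t)dt] − [∫₀¹B(0,t)dt]` for `A, B` ℚ-semialgebraic and
CONTINUOUS ON THE CLOSED TRIANGLE with a `C¹` potential `S` on the open triangle. Soundness
(eval = ∮_{∂Δ}(A da + B db) = 0) uses the closed-triangle continuity essentially: relax it to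
continuity off ONE vertex and the angle form `dθ` around that vertex is admitted, with period
`π/2`. Consequences: (i) the antecedent is correctly typed (not junk-unsound), so channel (K1)
needs a genuine non-`eval` invariant; (ii) `CurvePeriodsTransfer` must produce `A, B` continuous
up to the boundary (residues at vertices are NOT Green instances — they must be routed through
1a/2 after excising the vertex); (iii) the compiler Θ only ever meets bounded continuous
`A, B` on `Δ` — the "integrable blow-ups" of the why-line occur at cell ends of 1-dim reps, not
inside Green data. -/

/-- The open unit interval as a domain in `ℝ¹`. [folklore] -/
def unitIoo : Set (Fin 1 → ℝ) := {z | z 0 ∈ Ioo (0 : ℝ) 1}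

/-- Auxiliary: `unitIoo_eq_pi`. [folklore] -/
theorem unitIoo_eq_pi : unitIoo = Set.pi univ fun _ : Fin 1 => Ioo (0 : ℝ) 1 := by
  ext z; simp [unitIoo, Fin.forall_fin_one]

/-- Auxiliary: `isSemialgebraic_unitIoo`. [folklore] -/
theorem isSemialgebraic_unitIoo : IsSemialgebraic ℚ unitIoo := by
  have h := (isSemialgebraic_setOf_eval_lt (k := ℚ) (R := ℝ) (ι := Fin 1) (C 0) (X 0)).inter
    (isSemialgebraic_setOf_eval_lt (k := ℚ) (R := ℝ) (ι := Fin 1) (X 0) (C 1))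
  have hEq : unitIoo =
      {x : Fin 1 → ℝ | aeval x (C 0 : MvPolynomial (Fin 1) ℚ) < aeval x (X 0 : MvPolynomial (Fin 1) ℚ)} ∩
      {x : Fin 1 → ℝ | aeval x (X 0 : MvPolynomial (Fin 1) ℚ) < aeval x (C 1 : MvPolynomial (Fin 1) ℚ)} := by
    ext z; simp [unitIoo]
  rw [hEq]; exact h

/-- Auxiliary: `measurableSet_unitIoo`. [folklore] -/
theorem measurableSet_unitIoo : MeasurableSet unitIoo := by
  rw [unitIoo_eq_pi]; exact MeasurableSet.univ_pi fun _ => measurableSet_Ioo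

/-- Auxiliary: `volume_unitIoo_toReal`. [folklore] -/
theorem volume_unitIoo_toReal : (volume unitIoo).toReal = 1 := by
  rw [unitIoo_eq_pi, Real.volume_pi_Ioo_toReal (fun _ => zero_le_one)]
  simp

/-- Auxiliary: `volume_unitIoo_lt_top`. [folklore] -/
theorem volume_unitIoo_lt_top : volume unitIoo < ⊤ := by
  rw [unitIoo_eq_pi, Real.volume_pi_Ioo]
  exact ENNReal.prod_lt_top fun _ _ => ENNReal.ofReal_lt_top

/-- The zero representation on `(0,1)`. [folklore] -/
def zeroRep : KZ.IntegralRep 1 where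
  domain := unitIoo
  integrand := fun _ => 0
  isSemialgebraic_domain := isSemialgebraic_unitIoo
  isSemialgebraicFunOn_integrand := by
    simpa using isSemialgebraicFunOn_aeval isSemialgebraic_unitIoo (C 0 : MvPolynomial (Fin 1) ℚ)
  integrableOn := integrableOn_zero

/-- Auxiliary: `value_zeroRep`. [folklore] -/
@[simp] theorem value_zeroRep : zeroRep.value = 0 := by
  simp [KZ.IntegralRep.value, zeroRep]

/-- The hypotenuse integrand of the angle form: `t ↦ 1 / ((1 − t)² + t²)`. [folklore] -/
def hypDensity : (Fin 1 → ℝ) → ℝ := fun z => 1 / ((1 - z 0) ^ 2 + z 0 ^ 2)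

/-- Auxiliary: `hypDen_pos`. [folklore] -/
theorem hypDen_pos (t : ℝ) : 0 < (1 - t) ^ 2 + t ^ 2 := by nlinarith [sq_nonneg (1 - t), sq_nonneg t, sq_nonneg (2 * t - 1)]

/-- Auxiliary: `continuous_hypDensity`. [folklore] -/
theorem continuous_hypDensity : Continuous hypDensity := by
  unfold hypDensity
  exact continuous_const.div (by fun_prop) fun z => (hypDen_pos (z 0)).ne'

/-- Auxiliary: `isSemialgebraicFunOn_hypDensity`. [folklore] -/
theorem isSemialgebraicFunOn_hypDensity : IsSemialgebraicFunOn ℚ unitIoo hypDensity := by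
  refine (isSemialgebraicFunOn_aeval_div_aeval isSemialgebraic_unitIoo (C 1)
    ((C 1 - X 0) ^ 2 + X 0 ^ 2) ?_).congr ?_
  · intro z _
    simpa using (hypDen_pos (z 0)).ne'
  · intro z _
    simp [hypDensity]

/-- Auxiliary: `integrableOn_hypDensity`. [folklore] -/
theorem integrableOn_hypDensity : IntegrableOn hypDensity unitIoo := by
  have hK : IsCompact (Set.pi univ fun _ : Fin 1 => Icc (0 : ℝ) 1) :=
    isCompact_univ_pi fun _ => isCompact_Icc
  refine (continuous_hypDensity.continuousOn.integrableOn_compact hK).mono_set ?_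
  rw [unitIoo_eq_pi]
  exact Set.pi_mono fun _ _ => Ioo_subset_Icc_self

/-- `[∫₀¹ dt / ((1−t)² + t²)]` (value `π/2`). [folklore] -/
def hypRep : KZ.IntegralRep 1 where
  domain := unitIoo
  integrand := hypDensity
  isSemialgebraic_domain := isSemialgebraic_unitIoo
  isSemialgebraicFunOn_integrand := isSemialgebraicFunOn_hypDensity
  integrableOn := integrableOn_hypDensity

/-- `1 ≤ value hypRep` (indeed `= π/2`; the lower bound suffices). [folklore] -/
theorem one_le_value_hypRep : 1 ≤ hypRep.value := by
  have h1 : ∫ z in unitIoo, (1 : ℝ) = 1 := by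
    rw [setIntegral_const, smul_eq_mul, mul_one, measureReal_def, volume_unitIoo_toReal]
  rw [KZ.IntegralRep.value, show hypRep.domain = unitIoo from rfl,
    show hypRep.integrand = hypDensity from rfl, ← h1]
  refine setIntegral_mono_on (integrableOn_const volume_unitIoo_lt_top.ne) integrableOn_hypDensity
    measurableSet_unitIoo fun z hz => ?_
  have ht := hz
  simp only [unitIoo, mem_setOf_eq, mem_Ioo] at ht
  rw [hypDensity, le_div_iff₀ (hypDen_pos (z 0))]
  nlinarith [ht.1, ht.2]

/-- The angle form `dθ` around the vertex `0`: `A = −b/(a²+b²)`, `B = a/(a²+b²)` (value `0` at the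
vertex by Lean's `x / 0 = 0`), potential `S = arctan (b/a)` on `{a > 0}`. [folklore] -/
def angA : (Fin 2 → ℝ) → ℝ := fun p => -p 1 / (p 0 ^ 2 + p 1 ^ 2)
/-- Auxiliary: `angB`. [folklore] -/
def angB : (Fin 2 → ℝ) → ℝ := fun p => p 0 / (p 0 ^ 2 + p 1 ^ 2)
/-- Auxiliary: `angS`. [folklore] -/
def angS : (Fin 2 → ℝ) → ℝ := fun p => Real.arctan (p 1 * (p 0)⁻¹)

/-- The closed standard triangle. [folklore] -/
def triangle : Set (Fin 2 → ℝ) := {p | 0 ≤ p 0 ∧ 0 ≤ p 1 ∧ p 0 + p 1 ≤ 1}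

/-- Auxiliary: `isSemialgebraic_triangle`. [folklore] -/
theorem isSemialgebraic_triangle : IsSemialgebraic ℚ triangle := by
  have h := ((isSemialgebraic_setOf_eval_le (k := ℚ) (R := ℝ) (ι := Fin 2) (C 0) (X 0)).inter
    (isSemialgebraic_setOf_eval_le (k := ℚ) (R := ℝ) (ι := Fin 2) (C 0) (X 1))).inter
    (isSemialgebraic_setOf_eval_le (k := ℚ) (R := ℝ) (ι := Fin 2) (X 0 + X 1) (C 1))
  have hEq : triangle =
      ({x : Fin 2 → ℝ | aeval x (C 0 : MvPolynomial (Fin 2) ℚ) ≤ aeval x (X 0 : MvPolynomial (Fin 2) ℚ)} ∩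
        {x : Fin 2 → ℝ | aeval x (C 0 : MvPolynomial (Fin 2) ℚ) ≤ aeval x (X 1 : MvPolynomial (Fin 2) ℚ)}) ∩
      {x : Fin 2 → ℝ | aeval x (X 0 + X 1 : MvPolynomial (Fin 2) ℚ) ≤ aeval x (C 1 : MvPolynomial (Fin 2) ℚ)} := by
    ext p; simp [triangle, and_assoc]
  rw [hEq]; exact h

/-- Auxiliary: `isSemialgebraic_origin`. [folklore] -/
theorem isSemialgebraic_origin : IsSemialgebraic ℚ ({0} : Set (Fin 2 → ℝ)) := by
  have h := (isSemialgebraic_setOf_eval_eq_zero (k := ℚ) (R := ℝ) (ι := Fin 2) (X 0)).inter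
    (isSemialgebraic_setOf_eval_eq_zero (k := ℚ) (R := ℝ) (ι := Fin 2) (X 1))
  have hEq : ({0} : Set (Fin 2 → ℝ)) =
      {x : Fin 2 → ℝ | aeval x (X 0 : MvPolynomial (Fin 2) ℚ) = 0} ∩
      {x : Fin 2 → ℝ | aeval x (X 1 : MvPolynomial (Fin 2) ℚ) = 0} := by
    ext p
    simp only [mem_singleton_iff, mem_inter_iff, mem_setOf_eq, aeval_X]
    constructor
    · rintro rfl; simp
    · rintro ⟨h0, h1⟩; ext i; fin_cases i <;> simp [h0, h1]
  rw [hEq]; exact h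

/-- Auxiliary: `sq_add_sq_ne_zero_of_ne_zero`. [folklore] -/
theorem sq_add_sq_ne_zero_of_ne_zero {p : Fin 2 → ℝ} (hp : p ≠ 0) : p 0 ^ 2 + p 1 ^ 2 ≠ 0 := by
  intro h
  have h0 : p 0 = 0 := by nlinarith [sq_nonneg (p 0), sq_nonneg (p 1)]
  have h1 : p 1 = 0 := by nlinarith [sq_nonneg (p 0), sq_nonneg (p 1)]
  exact hp (by ext i; fin_cases i <;> simp [h0, h1])

/-- Gluing: a function semialgebraic on `s` and on `t` is semialgebraic on `s ∪ t`. [folklore] -/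
theorem isSemialgebraicFunOn_union {n : ℕ} {s t : Set (Fin n → ℝ)} {f : (Fin n → ℝ) → ℝ}
    (hs : IsSemialgebraicFunOn ℚ s f) (ht : IsSemialgebraicFunOn ℚ t f) :
    IsSemialgebraicFunOn ℚ (s ∪ t) f := by
  unfold IsSemialgebraicFunOn at hs ht ⊢
  convert hs.union ht using 1
  ext z
  simp only [mem_setOf_eq, mem_union]
  constructor
  · rintro ⟨x, hx | hx, rfl⟩
    · exact Or.inl ⟨x, hx, rfl⟩
    · exact Or.inr ⟨x, hx, rfl⟩
  · rintro (⟨x, hx, rfl⟩ | ⟨x, hx, rfl⟩)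
    · exact ⟨x, Or.inl hx, rfl⟩
    · exact ⟨x, Or.inr hx, rfl⟩

/-- A rational function `p/q` extended by `0` where `q = 0` is semialgebraic on any semialgebraic set
(glue the graph over `{q ≠ 0}` with the zero graph over `{q = 0}`). [folklore] -/
theorem isSemialgebraicFunOn_div_total {s : Set (Fin 2 → ℝ)} (hs : IsSemialgebraic ℚ s)
    (P Q : MvPolynomial (Fin 2) ℚ) :
    IsSemialgebraicFunOn ℚ s (fun x => aeval x P / aeval x Q) := by
  have hne : IsSemialgebraic ℚ (s ∩ {x : Fin 2 → ℝ | aeval x Q ≠ 0}) :=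
    hs.inter (isSemialgebraic_setOf_eval_ne_zero Q)
  have heq : IsSemialgebraic ℚ (s ∩ {x : Fin 2 → ℝ | aeval x Q = 0}) :=
    hs.inter (isSemialgebraic_setOf_eval_eq_zero Q)
  have h1 : IsSemialgebraicFunOn ℚ (s ∩ {x : Fin 2 → ℝ | aeval x Q ≠ 0}) (fun x => aeval x P / aeval x Q) :=
    isSemialgebraicFunOn_aeval_div_aeval hne P Q fun x hx => hx.2
  have h2 : IsSemialgebraicFunOn ℚ (s ∩ {x : Fin 2 → ℝ | aeval x Q = 0}) (fun x => aeval x P / aeval x Q) := by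
    refine (isSemialgebraicFunOn_aeval heq (C 0)).congr ?_
    intro x hx
    have hq : aeval x Q = 0 := hx.2
    simp [hq]
  convert isSemialgebraicFunOn_union h1 h2 using 1
  ext x
  simp only [mem_union, mem_inter_iff, mem_setOf_eq]
  tauto

/-- Auxiliary: `isSemialgebraicFunOn_angA`. [folklore] -/
theorem isSemialgebraicFunOn_angA : IsSemialgebraicFunOn ℚ triangle angA := by
  refine (isSemialgebraicFunOn_div_total isSemialgebraic_triangle (-X 1) (X 0 ^ 2 + X 1 ^ 2)).congr ?_
  intro p _; simp [angA, neg_div]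

/-- Auxiliary: `isSemialgebraicFunOn_angB`. [folklore] -/
theorem isSemialgebraicFunOn_angB : IsSemialgebraicFunOn ℚ triangle angB := by
  refine (isSemialgebraicFunOn_div_total isSemialgebraic_triangle (X 0) (X 0 ^ 2 + X 1 ^ 2)).congr ?_
  intro p _; simp [angB]

/-- Auxiliary: `continuousOn_angA`. [folklore] -/
theorem continuousOn_angA : ContinuousOn angA (triangle \ {0}) := by
  refine ContinuousOn.div (by fun_prop) (by fun_prop) fun p hp => ?_
  exact sq_add_sq_ne_zero_of_ne_zero hp.2

/-- Auxiliary: `continuousOn_angB`. [folklore] -/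
theorem continuousOn_angB : ContinuousOn angB (triangle \ {0}) := by
  refine ContinuousOn.div (by fun_prop) (by fun_prop) fun p hp => ?_
  exact sq_add_sq_ne_zero_of_ne_zero hp.2

/-- `dS = A da + B db` on `{a > 0}` (in particular on the open triangle). [folklore] -/
theorem hasFDerivAt_angS {p : Fin 2 → ℝ} (h0 : 0 < p 0) :
    HasFDerivAt angS (angA p • ContinuousLinearMap.proj (R := ℝ) (φ := fun _ : Fin 2 => ℝ) 0 +
      angB p • ContinuousLinearMap.proj (R := ℝ) (φ := fun _ : Fin 2 => ℝ) 1) p := by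
  have hinv : HasFDerivAt (fun q : Fin 2 → ℝ => (q 0)⁻¹)
      ((-(p 0 ^ 2)⁻¹) • ContinuousLinearMap.proj (R := ℝ) (φ := fun _ : Fin 2 => ℝ) 0) p :=
    (hasDerivAt_inv h0.ne').comp_hasFDerivAt p (hasFDerivAt_apply 0 p)
  have hmul : HasFDerivAt (fun q : Fin 2 → ℝ => q 1 * (q 0)⁻¹)
      (p 1 • ((-(p 0 ^ 2)⁻¹) • ContinuousLinearMap.proj (R := ℝ) (φ := fun _ : Fin 2 => ℝ) 0) +
        (p 0)⁻¹ • ContinuousLinearMap.proj (R := ℝ) (φ := fun _ : Fin 2 => ℝ) 1) p :=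
    (hasFDerivAt_apply 1 p).mul hinv
  have harc := (Real.hasDerivAt_arctan (p 1 * (p 0)⁻¹)).comp_hasFDerivAt p hmul
  refine harc.congr_fderiv ?_
  have hp0 : p 0 ≠ 0 := h0.ne'
  have hD : p 0 ^ 2 + p 1 ^ 2 ≠ 0 := by positivity
  ext v
  simp [angA, angB]
  field_simp

/-- The relaxed Green generator: the inlined generator of the crux's antecedent with
`ContinuousOn A Δ ∧ ContinuousOn B Δ` weakened to continuity on `Δ ∖ {0}` (all else verbatim). [folklore] -/
def greenRelaxed : Set KZ.FormalRep :=
  {g | ∃ (Δ : Set (Fin 2 → ℝ)) (A B S : (Fin 2 → ℝ) → ℝ) (r₀₁ r₁₂ r₀₂ : KZ.IntegralRep 1),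
    Δ = {p | 0 ≤ p 0 ∧ 0 ≤ p 1 ∧ p 0 + p 1 ≤ 1} ∧ IsSemialgebraicFunOn ℚ Δ A ∧
    IsSemialgebraicFunOn ℚ Δ B ∧ ContinuousOn A (Δ \ {0}) ∧ ContinuousOn B (Δ \ {0}) ∧
    (∀ p : Fin 2 → ℝ, 0 < p 0 → 0 < p 1 → p 0 + p 1 < 1 →
      HasFDerivAt S (A p • ContinuousLinearMap.proj (R := ℝ) (φ := fun _ : Fin 2 => ℝ) 0 +
        B p • ContinuousLinearMap.proj (R := ℝ) (φ := fun _ : Fin 2 => ℝ) 1) p) ∧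
    r₀₁.domain = {z | z 0 ∈ Set.Ioo 0 1} ∧ r₁₂.domain = {z | z 0 ∈ Set.Ioo 0 1} ∧
    r₀₂.domain = {z | z 0 ∈ Set.Ioo 0 1} ∧
    (∀ z ∈ r₀₁.domain, r₀₁.integrand z = A ![z 0, 0]) ∧
    (∀ z ∈ r₁₂.domain, r₁₂.integrand z = B ![1 - z 0, z 0] - A ![1 - z 0, z 0]) ∧
    (∀ z ∈ r₀₂.domain, r₀₂.integrand z = B ![0, z 0]) ∧
    g = KZ.of r₀₁ + KZ.of r₁₂ - KZ.of r₀₂}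

/-- The angle form is a relaxed Green instance: `[0] + [hypRep] − [0]`. [folklore] -/
theorem angleForm_mem_greenRelaxed :
    KZ.of zeroRep + KZ.of hypRep - KZ.of zeroRep ∈ greenRelaxed := by
  refine ⟨triangle, angA, angB, angS, zeroRep, hypRep, zeroRep, rfl, isSemialgebraicFunOn_angA,
    isSemialgebraicFunOn_angB, continuousOn_angA, continuousOn_angB,
    fun p h0 _ _ => hasFDerivAt_angS h0, rfl, rfl, rfl, ?_, ?_, ?_, rfl⟩
  · intro z _; simp [zeroRep, angA]
  · intro z _
    have hD := hypDen_pos (z 0)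
    simp only [hypRep, hypDensity, angA, angB, Matrix.cons_val_zero, Matrix.cons_val_one]
    field_simp
    ring
  · intro z _; simp [zeroRep, angB]

/-- TIGHTNESS of the antecedent's Green generator: continuity of `A, B` on the CLOSED triangle is
load-bearing for soundness — the relaxed generator has an element of value `≥ 1` (`= π/2`). [folklore] -/
theorem greenRelaxed_unsound : ∃ g ∈ greenRelaxed, KZ.eval g ≠ 0 := by
  refine ⟨_, angleForm_mem_greenRelaxed, ?_⟩
  rw [map_sub, map_add, KZ.eval_of, KZ.eval_of, value_zeroRep, zero_add, sub_zero]
  exact (lt_of_lt_of_le zero_lt_one one_le_value_hypRep).ne'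

end Summit.KontsevichZagierPeriods.SymplecticScissors.PlanarCompilerNegative
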